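import Summits.HodgeConjecture.HodgeConjecture.Theorems.Ring2WeilCoverageCMFieldRationalClassesDyadic
import HarnessLib

/-!
# Ring 2 — Weil-family coverage, CM-field rows: THE ROW OF A PRODUCT — `T(∏ tᵢ)` by the parity of the factors' rows, and the
  ASSEMBLY of a row from disjoint fibres (WEIL-FAMILY-COVERAGE «## b03», cell (xvi′), generic part; part 58)

research route conditional on HC_CM; not a corollary; Q11.4-sentence-2 already refuted in dim ≥ 3.

On Deligne's carrier `F = ℚ[S]/(R)`, `E = F(√θ)`, rows `T(t) = badPlaces t θ = {𝔭 : (t, θ)_𝔭 = -1}` [cite: Deligne1982HodgeCycles, §4 (1)].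
Multiplicativity of the local symbols (`T(xy) = T(x) ∆ T(y)`, O'Meara §63B) gives, for any finite product:

* §167 **`mem_badPlaces_prod_iff_odd_card`: `x ∈ T(∏_{i ∈ s} tᵢ) ⟺` the number of factors `i ∈ s` with `x ∈ T(tᵢ)` is ODD**
  (and the natural-number ∕ squarefree-prime-product forms) — the general form of parts 41∕46's «prime support» statements;
* §168 **THE ASSEMBLY PRINCIPLE**: if the rows `T(tᵢ)` are pairwise disjoint away from a fixed set `Z` of places, then
  `T(∏ tᵢ) ∖ Z = ⋃ᵢ (T(tᵢ) ∖ Z)`, and inside `Z` membership is the parity count — the mechanism behind the description of the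
  rational rows of every census table (biquadratic ∕ cyclic: `Z = ∅` resp. `{v_d}`, parts 41–52; `D₄`: `Z = {(√2), 𝔭_θ}`, parts 54–57).
No new definition, no named fact, no sorry; nothing about the Hodge conjecture is asserted.
-/

noncomputable section

set_option linter.dupNamespace false

open Polynomial NumberField IsDedekindDomain

namespace Summit.HodgeConjecture.HodgeConjecture.Ring2.WeilCoverageCM

open Literature.AlgebraicGeometry.Deligne1982
open Literature.NumberTheory.QuadraticForms

variable {R : Polynomial ℤ} [Fact (Irreducible (cmPolyQ R))] [Fact (Irreducible (realPolyQ R))]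

/-! ### §167 The row of a product: parity of the factors -/

section Products

variable {ι : Type*}

open scoped Classical in
/-- **`T(∏_{i ∈ s} tᵢ) ∋ x` iff the number of `i ∈ s` with `x ∈ T(tᵢ)` is odd** (all `tᵢ ≠ 0`; `T(1) = ∅`, `T(xy) = T(x) ∆ T(y)`,
induction on `s`). [cite: Omeara1963, §63B (multiplicativity of the Hilbert symbol)] [cite: Deligne1982HodgeCycles, §4 (1)] -/
theorem mem_badPlaces_prod_iff_odd_card (s : Finset ι) (t : ι → realField R) (ht : ∀ i ∈ s, t i ≠ 0)
    (x : HeightOneSpectrum (𝓞 (realField R)) ⊕ InfinitePlace (realField R)) :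
    x ∈ badPlaces (∏ i ∈ s, t i) (AdjoinRoot.root (realPolyQ R)) ↔
      Odd (s.filter fun i ↦ x ∈ badPlaces (t i) (AdjoinRoot.root (realPolyQ R))).card := by
  induction s using Finset.induction_on with
  | empty =>
    rw [Finset.prod_empty, badPlaces_one, Finset.filter_empty, Finset.card_empty]
    exact iff_of_false (Set.notMem_empty _) (Nat.not_odd_iff_even.2 ⟨0, rfl⟩)
  | insert a s ha ih =>
    have hta : t a ≠ 0 := ht a (Finset.mem_insert_self _ _)
    have hts : ∀ i ∈ s, t i ≠ 0 := fun i hi ↦ ht i (Finset.mem_insert_of_mem hi)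
    have hprod : ∏ i ∈ s, t i ≠ 0 := Finset.prod_ne_zero_iff.2 hts
    rw [Finset.prod_insert ha, badPlaces_mul hta hprod root_realPolyQ_ne_zero, Set.mem_symmDiff, ih hts,
      Finset.filter_insert]
    by_cases hxa : x ∈ badPlaces (t a) (AdjoinRoot.root (realPolyQ R))
    · rw [if_pos hxa, Finset.card_insert_of_notMem (fun h ↦ ha (Finset.mem_filter.1 h).1), Nat.odd_add_one]
      constructor
      · rintro (⟨-, h⟩ | ⟨-, h⟩)
        · exact h
        · exact absurd hxa h
      · exact fun h ↦ Or.inl ⟨hxa, h⟩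
    · rw [if_neg hxa]
      constructor
      · rintro (⟨h, -⟩ | ⟨h, -⟩)
        · exact absurd h hxa
        · exact h
      · exact fun h ↦ Or.inr ⟨h, hxa⟩

open scoped Classical in
/-- Natural-number form: **`x ∈ T(∏_{i ∈ s} nᵢ)` iff `#{i ∈ s : x ∈ T(nᵢ)}` is odd** (`nᵢ ≥ 1`). In particular for a finite set `P` of
primes and `n = ∏_{ℓ ∈ P} ℓ` (squarefree): `x ∈ T(n) ⟺ #{ℓ ∈ P : x ∈ T(ℓ)}` odd. [cite: Omeara1963, §63B] [cite: Deligne1982HodgeCycles, §4 (1)] -/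
theorem mem_badPlaces_natCast_prod_iff_odd_card (s : Finset ι) (n : ι → ℕ) (hn : ∀ i ∈ s, n i ≠ 0)
    (x : HeightOneSpectrum (𝓞 (realField R)) ⊕ InfinitePlace (realField R)) :
    x ∈ badPlaces ((∏ i ∈ s, n i : ℕ) : realField R) (AdjoinRoot.root (realPolyQ R)) ↔
      Odd (s.filter fun i ↦ x ∈ badPlaces (n i : realField R) (AdjoinRoot.root (realPolyQ R))).card := by
  rw [Nat.cast_prod]
  exact mem_badPlaces_prod_iff_odd_card s (fun i ↦ (n i : realField R)) (fun i hi ↦ by exact_mod_cast hn i hi) x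

/-! ### §168 The assembly principle: disjoint fibres away from a fixed set `Z` -/

open scoped Classical in
/-- **ASSEMBLY**: if the rows `T(tᵢ)`, `i ∈ s`, are pairwise DISJOINT outside a fixed set `Z` of places, then outside `Z` the row of the
product is their union: `x ∉ Z ⟹ (x ∈ T(∏ tᵢ) ⟺ ∃ i ∈ s, x ∈ T(tᵢ))` (the parity count of §167 is `0` or `1`).
[cite: Omeara1963, §63B] [cite: Deligne1982HodgeCycles, §4 (1)] -/
theorem mem_badPlaces_prod_iff_exists_of_disjoint (s : Finset ι) (t : ι → realField R) (ht : ∀ i ∈ s, t i ≠ 0)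
    (Z : Set (HeightOneSpectrum (𝓞 (realField R)) ⊕ InfinitePlace (realField R)))
    (hdisj : ∀ i ∈ s, ∀ j ∈ s, i ≠ j → ∀ y ∉ Z, y ∈ badPlaces (t i) (AdjoinRoot.root (realPolyQ R)) →
      y ∉ badPlaces (t j) (AdjoinRoot.root (realPolyQ R)))
    {x : HeightOneSpectrum (𝓞 (realField R)) ⊕ InfinitePlace (realField R)} (hx : x ∉ Z) :
    x ∈ badPlaces (∏ i ∈ s, t i) (AdjoinRoot.root (realPolyQ R)) ↔
      ∃ i ∈ s, x ∈ badPlaces (t i) (AdjoinRoot.root (realPolyQ R)) := by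
  rw [mem_badPlaces_prod_iff_odd_card s t ht x]
  set A := s.filter fun i ↦ x ∈ badPlaces (t i) (AdjoinRoot.root (realPolyQ R)) with hA
  -- at most one factor's row contains `x`
  have hle : A.card ≤ 1 := Finset.card_le_one.2 fun i hi j hj ↦ by
    rw [hA, Finset.mem_filter] at hi hj
    by_contra hij
    exact hdisj i hi.1 j hj.1 hij x hx hi.2 hj.2
  constructor
  · intro hodd
    have h1 : A.card = 1 := by obtain ⟨k, hk⟩ := hodd; omega
    obtain ⟨i, hi⟩ := Finset.card_eq_one.1 h1
    have hiA : i ∈ A := by rw [hi]; exact Finset.mem_singleton_self _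
    rw [hA, Finset.mem_filter] at hiA
    exact ⟨i, hiA.1, hiA.2⟩
  · rintro ⟨i, hi, hxi⟩
    have hiA : i ∈ A := by rw [hA, Finset.mem_filter]; exact ⟨hi, hxi⟩
    have h1 : A.card = 1 := le_antisymm hle (Finset.card_pos.2 ⟨i, hiA⟩)
    rw [h1]; exact odd_one

open scoped Classical in
/-- **ASSEMBLY, set form**: under the same disjointness, `T(∏_{i ∈ s} tᵢ) ∖ Z = ⋃_{i ∈ s} (T(tᵢ) ∖ Z)`; inside `Z` the membership of a
place is the parity count of §167. [cite: Omeara1963, §63B] [cite: Deligne1982HodgeCycles, §4 (1)] -/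
theorem badPlaces_prod_diff_eq_biUnion_of_disjoint (s : Finset ι) (t : ι → realField R) (ht : ∀ i ∈ s, t i ≠ 0)
    (Z : Set (HeightOneSpectrum (𝓞 (realField R)) ⊕ InfinitePlace (realField R)))
    (hdisj : ∀ i ∈ s, ∀ j ∈ s, i ≠ j → ∀ y ∉ Z, y ∈ badPlaces (t i) (AdjoinRoot.root (realPolyQ R)) →
      y ∉ badPlaces (t j) (AdjoinRoot.root (realPolyQ R))) :
    badPlaces (∏ i ∈ s, t i) (AdjoinRoot.root (realPolyQ R)) \ Z =
      ⋃ i ∈ s, (badPlaces (t i) (AdjoinRoot.root (realPolyQ R)) \ Z) := by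
  ext x
  simp only [Set.mem_sdiff, Set.mem_iUnion, exists_prop]
  constructor
  · rintro ⟨hxT, hxZ⟩
    obtain ⟨i, hi, hxi⟩ := (mem_badPlaces_prod_iff_exists_of_disjoint s t ht Z hdisj hxZ).1 hxT
    exact ⟨i, hi, hxi, hxZ⟩
  · rintro ⟨i, hi, hxi, hxZ⟩
    exact ⟨(mem_badPlaces_prod_iff_exists_of_disjoint s t ht Z hdisj hxZ).2 ⟨i, hi, hxi⟩, hxZ⟩

omit [Fact (Irreducible (cmPolyQ R))] in
open scoped Classical in
/-- **Units**: the product of non-zero factors as a unit, and the class of the product — `[∏ tᵢ] = ∏ [tᵢ]` in `F^×/Nm_{E/F}(E^×)`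
(so the rows of the rational integers are generated by the prime rows). [cite: Deligne1982HodgeCycles, §4 (1)] -/
theorem mk_prod_eq_prod_mk (s : Finset ι) (u : ι → (realField R)ˣ) :
    (QuotientGroup.mk (∏ i ∈ s, u i) : cmNormResidueGroup R) = ∏ i ∈ s, (QuotientGroup.mk (u i) : cmNormResidueGroup R) :=
  map_prod (QuotientGroup.mk' (Literature.AlgebraicGeometry.Motives.normUnitsSubgroup (realField R) (cmField R))) u s

end Products

end Summit.HodgeConjecture.HodgeConjecture.Ring2.WeilCoverageCM

end
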